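import Mathlib
import HarnessLib
import Literature.Analysis.FluidPDE.TypeIAncientMild
import Literature.Analysis.FluidPDE.TsaiLocalEnergy
import Summits.NavierStokesRegularity.NavierStokesRegularity.Theses.DulacContraction
import Summits.NavierStokesRegularity.NavierStokesRegularity.Theorems.SymmetryModuliCountForcedSymmetryStubSlabProfileOfNonzero
import Summits.NavierStokesRegularity.NavierStokesRegularity.Theorems.SymmetryModuliCountFarPastLedgerReduction

/-!
# Crux `ExtremalSpiralSymmetry` (stmt-NavierStokesRegularity-8215), line `registered`, stub 2b:
# the bounded-profile RDSS Type-I Liouville wall of the KNSS gauge IS crux `RDSSLiouvilleInClass` (stmt-8561)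

Support file (theorems only, `--supports stmt-NavierStokesRegularity-8215`; no definitions, no named facts). Lead c2.

Skeleton v5 of the line re-sources the rigidity half of the route's Conjecture M to the registered stub
`stub_rdssLiouville`: every element `u` of the KNSS-gauge Type-I ancient mild class `A_C` (`IsTypeIAncientMild C u`,
written out) which is `(c, R)`-rotated-discretely-self-similar about some `(0, x₀)` on `t < 0`,
`c Rᵀ u(c²t, x₀ + cRy) = u(t, x₀ + y)`, with `c > 1`, vanishes on `t < 0` — with NO spatial decay assumed (a merely
bounded profile). This file proves that this wall is implied by the crux `RDSSLiouvilleInClass` of route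
`DulacContraction` (stmt-NavierStokesRegularity-8561, Albritton–Barker's slab class `𝒦`: suitable weak on
`ℝ³ × (−∞,0)` with a weak gradient, `𝐈 < ∞`, the rate, classical on `t < 0`, invariant a.e. under one similarity
with factor `l > 1` ⇒ the origin is regular):

* `rdss_isBackwardSingularPoint_of_ne_zero` — a field continuous on the open slab which is `(c, R)`-RDSS about the
  origin on `t < 0` with `c > 1` and does not vanish identically there is backward-SINGULAR at the origin: along
  the inverse orbit `(t, y) ↦ (c⁻²t, c⁻¹R⁻¹y)` the norm is multiplied by `c` at each step while the points enter
  every parabolic cylinder `Q_r(0,0)` (`isBackwardSingularPoint_of_forall_exists_continuousAt`);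
* `stub_rdssLiouville_of_rdssLiouvilleInClass` — `RDSSLiouvilleInClass → stub_rdssLiouville` (statement of the stub
  verbatim): translate the centre to the origin (`isTypeIAncientMild_translate`), take the slab-profile package of
  the class — ONE pressure making `u` classical on `(−∞,0)`, suitable weak on the slab with weak gradient `∇u` and
  `𝐈 < ∞` (`slabProfile_of_isTypeIAncientMild`, which rests on the PROVED crux `FarPastLedger`, stmt-14060) — feed
  the RDSS identity (pointwise on `t < 0`, hence a.e. on the slab, `τ = 0`, `ξ = 0`) to `RDSSLiouvilleInClass`, and
  conclude from the first bullet.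

So the rigidity half of Conjecture M is not new mathematics: modulo landed bridges it is EXACTLY the named open
problem stmt-8561 (Tsai 2018 Conj. 8.8/8.9 = Bradshaw–Tsai 2017 OP 5.1 in the class `𝒦`), whose own line
(`Cruxes/RDSSLiouvilleInClass/Lines/birth.lean`) has stub 3b landed and 3a/3c reduced. CONDITIONAL on that crux
(taken as an explicit hypothesis, never asserted).

References: D. Albritton, T. Barker, J. Math. Fluid Mech. 21 (2019) = arXiv:1811.00502, §1 [AlbrittonBarker2019];
Z. Bradshaw, T.-P. Tsai, Comm. PDE 42 (2017) = arXiv:1610.05680, §5 OP 5.1 [BradshawTsai2017CPDE]; T.-P. Tsai, GSM 192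
(2018), Conj. 8.8–8.9 [Tsai2018]; G. Koch, N. Nadirashvili, G. Seregin, V. Šverák, Acta Math. 203 (2009), §4
[KochNadirashviliSereginSverak2009].
-/

noncomputable section

-- the summit and its single sub-problem share the name (CONVENTIONS §1), as in every Theorems file
set_option linter.dupNamespace false

open Set MeasureTheory Filter Topology Function
open Literature.Analysis.FluidPDE

namespace Summit.NavierStokesRegularity.NavierStokesRegularity.Theorems.ExtremalSpiralSymmetry.Registered

/-! ### A nontrivial RDSS field is singular at its centre -/

/-- **One step down the inverse orbit.** If `c Rᵀ v(c²t, cRy) = v(t, y)` on `t < 0`, then at the point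
`(c⁻²t, c⁻¹R⁻¹y)` (again in the slab) the field equals `c Rᵀ v(t, y)`; in particular its norm is `c ‖v(t,y)‖`.
[folklore] -/
theorem rdss_step {v : ℝ → EuclideanSpace ℝ (Fin 3) → EuclideanSpace ℝ (Fin 3)} {c : ℝ} (hc : 0 < c)
    {R : EuclideanSpace ℝ (Fin 3) ≃ₗᵢ[ℝ] EuclideanSpace ℝ (Fin 3)}
    (h : ∀ t < (0 : ℝ), ∀ y, c • R.symm (v (c ^ 2 * t) (c • R y)) = v t y) {t : ℝ} (ht : t < 0)
    (y : EuclideanSpace ℝ (Fin 3)) :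
    v (c⁻¹ ^ 2 * t) (c⁻¹ • R.symm y) = c • R.symm (v t y) := by
  have hc2 : 0 < c⁻¹ ^ 2 := by positivity
  have key := h (c⁻¹ ^ 2 * t) (mul_neg_of_pos_of_neg hc2 ht) (c⁻¹ • R.symm y)
  have e1 : c ^ 2 * (c⁻¹ ^ 2 * t) = t := by field_simp
  have e2 : c • R (c⁻¹ • R.symm y) = y := by
    rw [LinearIsometryEquiv.map_smul, LinearIsometryEquiv.apply_symm_apply, smul_smul,
      mul_inv_cancel₀ hc.ne', one_smul]
  rw [e1, e2] at key
  exact key.symm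

/-- **A nontrivial rotated-DSS field is backward-singular at its centre.** Let `v` be continuous on the open slab
`t < 0` and `(c, R)`-rotated-discretely-self-similar about the space–time origin there, `c Rᵀ v(c²t, cRy) = v(t,y)`,
with `c > 1`. If `v(t₀, y₀) ≠ 0` for some `t₀ < 0`, then the origin is a backward singular point of `v`: the points
`zₙ = (c⁻²ⁿ t₀, c⁻ⁿ R⁻ⁿ y₀)` enter every parabolic cylinder `Q_r(0, 0)`, `v` is continuous at each of them, and
`‖v(zₙ)‖ = cⁿ ‖v(t₀, y₀)‖ → ∞`. [folklore] -/
theorem rdss_isBackwardSingularPoint_of_ne_zero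
    {v : ℝ → EuclideanSpace ℝ (Fin 3) → EuclideanSpace ℝ (Fin 3)} {c : ℝ} (hc : 1 < c)
    {R : EuclideanSpace ℝ (Fin 3) ≃ₗᵢ[ℝ] EuclideanSpace ℝ (Fin 3)}
    (hcont : ContinuousOn (uncurry v) (Iio (0 : ℝ) ×ˢ univ))
    (h : ∀ t < (0 : ℝ), ∀ y, c • R.symm (v (c ^ 2 * t) (c • R y)) = v t y)
    {t₀ : ℝ} (ht₀ : t₀ < 0) {y₀ : EuclideanSpace ℝ (Fin 3)} (hne : v t₀ y₀ ≠ 0) :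
    IsBackwardSingularPoint v 0 := by
  have hc0 : 0 < c := zero_lt_one.trans hc
  -- the inverse orbit
  set p : ℕ → ℝ × EuclideanSpace ℝ (Fin 3) :=
    fun n => Nat.rec (t₀, y₀) (fun _ q => (c⁻¹ ^ 2 * q.1, c⁻¹ • R.symm q.2)) n with hp
  have hp0 : p 0 = (t₀, y₀) := rfl
  have hpsucc : ∀ n, p (n + 1) = (c⁻¹ ^ 2 * (p n).1, c⁻¹ • R.symm (p n).2) := fun n => rfl
  -- invariants along the orbit
  have hinv : ∀ n, (p n).1 = (c⁻¹ ^ 2) ^ n * t₀ ∧ ‖(p n).2‖ = c⁻¹ ^ n * ‖y₀‖ ∧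
      ‖v (p n).1 (p n).2‖ = c ^ n * ‖v t₀ y₀‖ := by
    intro n
    induction n with
    | zero => simp [hp0]
    | succ n ih =>
      obtain ⟨h1, h2, h3⟩ := ih
      have htn : (p n).1 < 0 := by
        rw [h1]; exact mul_neg_of_pos_of_neg (by positivity) ht₀
      refine ⟨?_, ?_, ?_⟩
      · rw [hpsucc, h1]; ring
      · rw [hpsucc]
        simp only
        rw [norm_smul, LinearIsometryEquiv.norm_map, h2, Real.norm_of_nonneg (by positivity)]
        ring
      · rw [hpsucc]
        simp only
        rw [rdss_step hc0 h htn, norm_smul, LinearIsometryEquiv.norm_map, h3,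
          Real.norm_of_nonneg hc0.le]
        ring
  have hneg : ∀ n, (p n).1 < 0 := fun n => by
    rw [(hinv n).1]; exact mul_neg_of_pos_of_neg (by positivity) ht₀
  -- choose `n` large
  refine isBackwardSingularPoint_of_forall_exists_continuousAt fun r hr M => ?_
  have hq : c⁻¹ < 1 := inv_lt_one_of_one_lt₀ hc
  have hq0 : 0 ≤ c⁻¹ := by positivity
  have hlim1 : Tendsto (fun n : ℕ => (c⁻¹ ^ 2) ^ n * t₀) atTop (𝓝 (0 * t₀)) :=
    (tendsto_pow_atTop_nhds_zero_of_lt_one (by positivity)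
      (by nlinarith [hq, hq0])).mul_const t₀
  rw [zero_mul] at hlim1
  have hlim2 : Tendsto (fun n : ℕ => c⁻¹ ^ n * ‖y₀‖) atTop (𝓝 (0 * ‖y₀‖)) :=
    (tendsto_pow_atTop_nhds_zero_of_lt_one hq0 hq).mul_const _
  rw [zero_mul] at hlim2
  have hlim3 : Tendsto (fun n : ℕ => c ^ n * ‖v t₀ y₀‖) atTop atTop :=
    (tendsto_pow_atTop_atTop_of_one_lt hc).atTop_mul_const (norm_pos_iff.2 hne)
  have e1 : ∀ᶠ n : ℕ in atTop, -r ^ 2 < (c⁻¹ ^ 2) ^ n * t₀ :=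
    hlim1.eventually (Ioi_mem_nhds (by nlinarith : -r ^ 2 < 0))
  have e2 : ∀ᶠ n : ℕ in atTop, c⁻¹ ^ n * ‖y₀‖ < r := hlim2.eventually (Iio_mem_nhds hr)
  have e3 : ∀ᶠ n : ℕ in atTop, M < c ^ n * ‖v t₀ y₀‖ := hlim3.eventually (eventually_gt_atTop M)
  obtain ⟨n, hn1, hn2, hn3⟩ := (e1.and (e2.and e3)).exists
  obtain ⟨i1, i2, i3⟩ := hinv n
  refine ⟨p n, ?_, ?_, ?_⟩
  · rw [mem_parabolicCylinder]
    refine ⟨⟨?_, ?_⟩, ?_⟩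
    · simp only [Prod.fst_zero, zero_sub]
      rw [i1]; exact hn1
    · simpa using hneg n
    · rw [Prod.snd_zero, dist_zero_right, i2]; exact hn2
  · exact hcont.continuousAt ((isOpen_Iio.prod isOpen_univ).mem_nhds ⟨hneg n, mem_univ _⟩)
  · show M < ‖v (p n).1 (p n).2‖
    rw [i3]; exact hn3

/-! ### The wall of the line from crux stmt-8561 -/

/-- **Stub 2b of the line from `RDSSLiouvilleInClass` (stmt-NavierStokesRegularity-8561).** Assuming the crux
`RDSSLiouvilleInClass` of route `DulacContraction` (hypothesis), every element of `A_C` which is `(c, R)`-RDSS about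
some `(0, x₀)` on `t < 0` with `c > 1` vanishes on `t < 0` — the registered stub `stub_rdssLiouville` of skeleton v5,
statement verbatim: translate `x₀` to the origin (`isTypeIAncientMild_translate`); the class supplies one pressure
for which the translate is classical on `(−∞, 0)`, suitable weak on the slab with weak gradient `∇u` and `𝐈 < ∞`
(`slabProfile_of_isTypeIAncientMild`, resting on the proved `FarPastLedger`); the RDSS identity holds a.e. on the
slab (`τ = 0`, `ξ = 0`), so the crux makes the origin regular, whereas a nontrivial RDSS field is singular at its
centre (`rdss_isBackwardSingularPoint_of_ne_zero`). CONDITIONAL on stmt-8561. [cite: AlbrittonBarker2019, §1] -/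
theorem stub_rdssLiouville_of_rdssLiouvilleInClass :
    _root_.Summit.NavierStokesRegularity.NavierStokesRegularity.Theses.DulacContraction.RDSSLiouvilleInClass →
    ∀ (C : ℝ) (u : ℝ → EuclideanSpace ℝ (Fin 3) → EuclideanSpace ℝ (Fin 3)) (c : ℝ)
      (R : EuclideanSpace ℝ (Fin 3) ≃ₗᵢ[ℝ] EuclideanSpace ℝ (Fin 3)) (x₀ : EuclideanSpace ℝ (Fin 3)),
      (ContDiffOn ℝ (⊤ : ℕ∞) (Function.uncurry u) (Set.Iio 0 ×ˢ Set.univ) ∧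
          (∀ t < 0, Literature.Analysis.FluidPDE.VectorCalculus.IsDivFree (u t)) ∧
          (∀ s t : ℝ, s < t → t < 0 → ∀ x, u t x =
            Literature.Analysis.FluidPDE.heatFlow (u s) (t - s) x -
              ∫ τ in Set.Ioo s t, ∫ y,
                Literature.Analysis.FluidPDE.oseenKernel (t - τ) (x - y) (u τ y) (u τ y)) ∧
          Literature.Analysis.FluidPDE.HasTypeITimeDecay C u) →
      1 < c →
      (∀ t < (0 : ℝ), ∀ y, c • R.symm (u (c ^ 2 * t) (x₀ + c • R y)) = u t (x₀ + y)) →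
      ∀ t < (0 : ℝ), ∀ x, u t x = 0 := by
  intro h8561 C u c R x₀ hcls hc hrdss t ht x
  have hA : IsTypeIAncientMild C u := isTypeIAncientMild_iff.2 hcls
  -- translate the centre to the origin
  set v : ℝ → EuclideanSpace ℝ (Fin 3) → EuclideanSpace ℝ (Fin 3) := fun s y => u s (x₀ + y) with hv
  have hAv : IsTypeIAncientMild C v :=
    Summit.NavierStokesRegularity.NavierStokesRegularity.Theorems.isTypeIAncientMild_translate hA x₀
  have hrdss' : ∀ s < (0 : ℝ), ∀ y, c • R.symm (v (c ^ 2 * s) (c • R y)) = v s y := fun s hs y => by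
    simp only [hv]
    exact hrdss s hs y
  -- the slab-profile package of the class (one pressure)
  obtain ⟨p, hcl, hsw, hwg, hI⟩ :=
    Summit.NavierStokesRegularity.NavierStokesRegularity.Theorems.SymmetryModuliCountForcedSymmetry.slabProfile_of_isTypeIAncientMild
      hAv
  have hdecay : HasTypeITimeDecay C v := hAv.hasTypeITimeDecay
  -- the RDSS identity a.e. on the slab, in the `act` form of stmt-8561 with `τ = 0`, `ξ = 0`
  have hae : (fun z : ℝ × EuclideanSpace ℝ (Fin 3) =>
        c • R.symm (v (c ^ 2 * z.1 + 0) (c • R z.2 + 0))) =ᵐ[volume.restrict (Iio (0 : ℝ) ×ˢ univ)]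
      (fun z : ℝ × EuclideanSpace ℝ (Fin 3) => v z.1 z.2) := by
    refine (ae_restrict_iff' (measurableSet_Iio.prod MeasurableSet.univ)).2 (Eventually.of_forall ?_)
    rintro ⟨s, y⟩ ⟨hs, -⟩
    simp only [add_zero]
    exact hrdss' s hs y
  have hreg : ¬ IsBackwardSingularPoint v 0 := by
    have h := h8561
    dsimp only [Summit.NavierStokesRegularity.NavierStokesRegularity.Theses.DulacContraction.RDSSLiouvilleInClass]
      at h
    exact h v p _ C hsw hwg hI hdecay hcl ⟨c, hc, R, 0, 0, le_rfl, hae⟩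
  -- so `v` vanishes on the slab
  by_contra hne
  have hne' : v t (x - x₀) ≠ 0 := by simpa [hv] using hne
  exact hreg (rdss_isBackwardSingularPoint_of_ne_zero hc hAv.contDiffOn.continuousOn hrdss' ht hne')

end Summit.NavierStokesRegularity.NavierStokesRegularity.Theorems.ExtremalSpiralSymmetry.Registered

end
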